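import Literature.NumberTheory.EllipticCurves.IwasawaAlgebraGenericTwistFiniteProofs
import Literature.NumberTheory.EllipticCurves.IwasawaAlgebraSpecializationCountProofs
import Mathlib.RingTheory.Polynomial.Eisenstein.Basic
import HarnessLib

/-!
# Uniform boundedness of the `q_m`-torsion of a finitely generated `Λ`-module at Howard's
# Eisenstein primes `q_m = T^m + p` (module theory over `Λ = ℤ_p⟦T⟧`; proofs file)

Topic `NumberTheory/EllipticCurves`. THEOREMS ONLY (no definition, no named fact, no instance, no
`sorry`), in the vocabulary of the tree (`IwasawaAlgebra p = PowerSeries ℤ_[p]`,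
`Submodule.torsionBy Λ M θ = M[θ]`, `Module.Finite`, `Finite`, `Nat.card`).

WHAT. Let `M` be a finitely generated `Λ`-module and `q_m = T^m + p ∈ Λ` (`m ≥ 1`; Eisenstein, hence a
prime element of `Λ`, and `q_m`, `q_{m'}` are non-associated for `m ≠ m'` since `Λ/(q_m)` is
`ℤ_p`-free of rank `m`). Then:

* §1–§3 (`prime_X_pow_add_C`, `eq_of_associated_X_pow_add_C`, `finite_setOf_X_pow_add_C_dvd`,
  `finite_quotient_span_pair_X_pow_add_C`): a non-zero `f ∈ Λ` is divisible by `q_m` for only finitely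
  many `m ≥ 1`, and `Λ/(f, q_m)` is finite when `q_m ∤ f`;
* §4 (`finite_setOf_not_finite_torsionBy_X_pow_add_C`): `M[q_m]` is finite for all but finitely many
  `m` (the exceptional `m` are among those with `q_m ∣ f`, `f ≠ 0` an annihilator of `M_{Λ-tors}`);
* §5 (`exists_finite_submodule_forall_finite_le`, `forall_finite_eq_bot_quotient_of_forall_finite_le`):
  a Noetherian module has a largest finite submodule `M_fin`, and `M/M_fin` has no non-zero finite
  submodule;
* §6 (MAIN: `exists_finite_forall_torsionBy_X_pow_add_C_le`,
  `exists_forall_nat_card_torsionBy_X_pow_add_C_le`, `finite_setOf_torsionBy_X_pow_add_C_ne_bot`):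
  **`M[q_m] ⊆ M_fin` for all but finitely many `m`**, hence there are `B, m₀` with
  `#M[q_m] ≤ B` for all `m ≥ m₀` — the `q_m`-torsion is bounded UNIFORMLY in `m` — and in a module
  without non-zero finite submodules `M[q_m] = 0` for all but finitely many `m`.

WHY (use). In Howard's treatment of the height-one prime `𝔓 = pΛ` of the anticyclotomic main
conjecture by specialisation at `𝔮 = q_m = T^m + p` [Howard 2004, proof of Thm. 2.2.10: "The case
`𝔭 = pΛ` is dealt with in an entirely similar fashion, taking `𝔮 = T^m + p`"], the control theorem
at `𝔮` (his Lemma 2.2.7 / Prop. 2.2.8, after Mazur–Rubin Lemma 5.3.13) has error terms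
`H²(K_v, Fil_v 𝐓)[𝔮]` (local, `v ∣ p`) and `H²(K_Σ/K, 𝐓)[𝔮]` (global), `𝔮`-torsion submodules of
finitely generated `Λ`-modules. For the `m → ∞` limit that extracts `μ`-invariants from the
specialised lengths (the tree's `IwasawaAlgebra.lengthAt_le_two_mul_of_card_quotSMulTop_qm_le`,
whose hypothesis is a CARDINALITY inequality with a constant `p^{C₀}` independent of `m`) these
errors must be bounded in cardinality uniformly in `m`; §6 is exactly that statement (the
specialised-Kolyvagin-system port of cell `pub/bsd-print-x9`, crux idea `specialise-first-mu-x10b`,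
S1 term ledger: global term and local term (2)). The mechanism is Greenberg's generic-twist argument
[Greenberg LNM 1716, proof of Prop. 4.9, p. 117] run along the family `q_m` instead of `T − c`
(the tree's `IwasawaAlgebraGenericTwistFiniteProofs`, whose §3/§7 lemmas are reused), together with
the largest finite submodule. Nothing about Selmer groups or Galois cohomology is asserted here.

References: [Howard2004HeegnerKolyvagin] B. Howard, *The Heegner point Kolyvagin system*, Compositio
Math. 140 (2004), proof of Thm. 2.2.10 and Lemma 2.2.7 / Prop. 2.2.8; [GreenbergLNM1716] R. Greenberg,
LNM 1716 (1999), §4 p. 117; [Washington1997] §7.1 (distinguished polynomials, Prop. 7.2), §13.2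
(`Λ` is a UFD; Nakayama); [NeukirchSchmidtWingberg2008] Ch. V §1 (5.1.4) Remark 4, (5.3.1).
-/

noncomputable section

open scoped Classical Polynomial

namespace Literature.NumberTheory.EllipticCurves.IwasawaAlgebra

variable (p : ℕ) [hp : Fact p.Prime]

/-! ## §1 Howard's Eisenstein polynomials `q_m = T^m + p` as prime elements of `Λ` -/

/-- `q_m = T^m + p ≠ 0` in `Λ` (its constant coefficient is `p ≠ 0`, or its coefficient of `T^m` is
`1` resp. `1 + p`). [cite: Washington1997, §7.1 (distinguished polynomials)] -/
theorem X_pow_add_C_ne_zero (m : ℕ) :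
    (PowerSeries.X ^ m + PowerSeries.C (p : ℤ_[p]) : IwasawaAlgebra p) ≠ 0 := by
  intro h
  have h1 := congrArg (PowerSeries.coeff m) h
  rw [map_add, PowerSeries.coeff_X_pow_self, PowerSeries.coeff_C, map_zero] at h1
  have hp0 : (p : ℤ_[p]) ≠ 0 := by exact_mod_cast hp.out.ne_zero
  split_ifs at h1 with hm
  · have h2 : ((1 : ℕ) : ℤ_[p]) + (p : ℤ_[p]) = 0 := by exact_mod_cast h1
    have h3 : ((1 + p : ℕ) : ℤ_[p]) = 0 := by push_cast; exact h2
    exact (Nat.cast_ne_zero.mpr (by omega : 1 + p ≠ 0)) h3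
  · rw [add_zero] at h1
    exact one_ne_zero h1

/-- For `m ≥ 1`, `q_m = T^m + p` lies in the maximal ideal `𝔪_Λ = (p, T)` (its constant term is `p`).
[cite: Washington1997, §7.1] -/
theorem X_pow_add_C_mem_maximalIdeal {m : ℕ} (hm : 1 ≤ m) :
    (PowerSeries.X ^ m + PowerSeries.C (p : ℤ_[p]) : IwasawaAlgebra p) ∈
      IsLocalRing.maximalIdeal (IwasawaAlgebra p) := by
  rw [IsLocalRing.mem_maximalIdeal, mem_nonunits_iff, PowerSeries.isUnit_iff_constantCoeff, map_add,
    map_pow, PowerSeries.constantCoeff_X, zero_pow (by omega), zero_add, PowerSeries.constantCoeff_C]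
  have : (p : ℤ_[p]) ∈ IsLocalRing.maximalIdeal ℤ_[p] := by
    rw [PadicInt.maximalIdeal_eq_span_p]; exact Ideal.mem_span_singleton_self _
  exact (IsLocalRing.mem_maximalIdeal _).mp this

/-- For `m ≥ 1`, `q_m = T^m + p` is not a unit of `Λ`. [cite: Washington1997, §7.1] -/
theorem not_isUnit_X_pow_add_C {m : ℕ} (hm : 1 ≤ m) :
    ¬ IsUnit (PowerSeries.X ^ m + PowerSeries.C (p : ℤ_[p]) : IwasawaAlgebra p) :=
  (IsLocalRing.mem_maximalIdeal _).mp (X_pow_add_C_mem_maximalIdeal p hm)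

/-- `X^m + p ∈ ℤ_p[X]` is irreducible for `m ≥ 1` (Eisenstein's criterion at `(p)`: monic, lower
coefficients in `(p)`, constant coefficient `p ∉ (p)^2`). [cite: Washington1997, §7.1 (distinguished polynomials)] -/
theorem irreducible_X_pow_add_C_polynomial {m : ℕ} (hm : 1 ≤ m) :
    Irreducible (Polynomial.X ^ m + Polynomial.C (p : ℤ_[p]) : ℤ_[p][X]) := by
  have hq := isDistinguishedAt_X_pow_add_C p hm
  have hm0 : m ≠ 0 := by omega
  have hdeg : (Polynomial.X ^ m + Polynomial.C (p : ℤ_[p]) : ℤ_[p][X]).natDegree = m :=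
    Polynomial.natDegree_X_pow_add_C
  have hne : IsLocalRing.maximalIdeal ℤ_[p] ≠ ⊤ := (IsLocalRing.maximalIdeal.isMaximal ℤ_[p]).ne_top
  refine Polynomial.IsEisensteinAt.irreducible (𝓟 := IsLocalRing.maximalIdeal ℤ_[p]) ⟨?_, ?_, ?_⟩
    (IsLocalRing.maximalIdeal.isMaximal ℤ_[p]).isPrime hq.monic.isPrimitive (by rw [hdeg]; omega)
  · rw [hq.monic.leadingCoeff]
    exact fun h => hne ((Ideal.eq_top_iff_one _).mpr h)
  · exact fun hn => hq.mem hn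
  · rw [Polynomial.coeff_add, Polynomial.coeff_X_pow, if_neg (Ne.symm hm0), zero_add,
      Polynomial.coeff_C_zero, PadicInt.maximalIdeal_eq_span_p, Ideal.span_singleton_pow,
      Ideal.mem_span_singleton]
    rintro ⟨c, hc⟩
    have hp0 : (p : ℤ_[p]) ≠ 0 := by exact_mod_cast hp.out.ne_zero
    have h1 : (p : ℤ_[p]) * (1 - p * c) = 0 := by rw [mul_sub, mul_one, sub_eq_zero, ← mul_assoc, ← sq]; exact hc
    rcases mul_eq_zero.mp h1 with h | h
    · exact hp0 h
    · have hu : IsUnit (p : ℤ_[p]) := IsUnit.of_mul_eq_one c (by linear_combination (-1 : ℤ_[p]) * h)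
      exact PadicInt.irreducible_p.not_isUnit hu

/-- **`q_m = T^m + p` is a prime element of `Λ = ℤ_p⟦T⟧`** for `m ≥ 1`: it is an irreducible
distinguished polynomial, so `Λ/(q_m) ≅ ℤ_p[X]/(q_m)` is a domain by Weierstrass division (the tree's
`isPrime_span_coe`). [cite: Washington1997, §7.1 Prop. 7.2 and §13.2 (Lemma 13.7)]
[cite: Howard2004HeegnerKolyvagin, proof of Thm. 2.2.10 (𝔮 = T^m + p is a height-one prime)] -/
theorem prime_X_pow_add_C {m : ℕ} (hm : 1 ≤ m) :
    Prime (PowerSeries.X ^ m + PowerSeries.C (p : ℤ_[p]) : IwasawaAlgebra p) := by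
  have hP := isPrime_span_coe p (isDistinguishedAt_X_pow_add_C p hm)
    (irreducible_X_pow_add_C_polynomial p hm)
  rw [coe_X_pow_add_C] at hP
  exact (Ideal.span_singleton_prime (X_pow_add_C_ne_zero p m)).mp hP

/-- `rank_{ℤ_p} Λ/(q_m) = m` for `m ≥ 1` (`Λ/(q_m) = ℤ_p[π]`, `π^m = −p`).
[cite: Washington1997, Prop. 13.8] -/
theorem finrank_quotient_span_X_pow_add_C {m : ℕ} (hm : 1 ≤ m) :
    Module.finrank ℤ_[p] (IwasawaAlgebra p ⧸
      Ideal.span {(PowerSeries.X ^ m + PowerSeries.C (p : ℤ_[p]) : IwasawaAlgebra p)}) = m := by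
  have hq := isDistinguishedAt_X_pow_add_C p hm
  have h1 : Ideal.span {(PowerSeries.X ^ m + PowerSeries.C (p : ℤ_[p]) : IwasawaAlgebra p)} =
      Ideal.span {((Polynomial.X ^ m + Polynomial.C (p : ℤ_[p]) : ℤ_[p][X]) : IwasawaAlgebra p) ^ 1} := by
    rw [pow_one, coe_X_pow_add_C]
  rw [h1, finrank_quotient_pow p hq 1, one_mul, Polynomial.natDegree_X_pow_add_C]

/-- **Distinct `m` give non-associated `q_m`**: if `q_m` and `q_{m'}` are associated (`m, m' ≥ 1`) then
`m = m'` — they generate the same ideal, and `rank_{ℤ_p} Λ/(q_m) = m`. ("The `θ`'s are irreducible and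
relatively prime", in Greenberg's phrase for the linear family.)
[cite: NeukirchSchmidtWingberg2008, Ch. V §1 (5.3.1)] [cite: Washington1997, Prop. 13.8] -/
theorem eq_of_associated_X_pow_add_C {m m' : ℕ} (hm : 1 ≤ m) (hm' : 1 ≤ m')
    (h : Associated (PowerSeries.X ^ m + PowerSeries.C (p : ℤ_[p]) : IwasawaAlgebra p)
      (PowerSeries.X ^ m' + PowerSeries.C (p : ℤ_[p]))) : m = m' := by
  have hI : Ideal.span {(PowerSeries.X ^ m + PowerSeries.C (p : ℤ_[p]) : IwasawaAlgebra p)} =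
      Ideal.span {(PowerSeries.X ^ m' + PowerSeries.C (p : ℤ_[p]) : IwasawaAlgebra p)} :=
    Ideal.span_singleton_eq_span_singleton.mpr h
  have e := Ideal.quotientEquivAlgOfEq ℤ_[p] hI
  rw [← finrank_quotient_span_X_pow_add_C p hm, ← finrank_quotient_span_X_pow_add_C p hm']
  exact e.toLinearEquiv.finrank_eq

/-! ## §2 A non-zero `f ∈ Λ` is divisible by `q_m` for only finitely many `m` -/

/-- **Finitely many Eisenstein divisors**: a non-zero `f ∈ Λ = ℤ_p⟦T⟧` is divisible by `q_m = T^m + p`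
for only finitely many `m ≥ 1` — each such prime `q_m` is associated to a member of the finite multiset
of prime factors of `f` in the factorial ring `Λ`, and distinct `m` give non-associated `q_m`.
[cite: Washington1997, §13.2 (`Λ` is a UFD)] [cite: GreenbergLNM1716, §4 p. 117] -/
theorem finite_setOf_X_pow_add_C_dvd {f : IwasawaAlgebra p} (hf : f ≠ 0) :
    {m : ℕ | 1 ≤ m ∧ (PowerSeries.X ^ m + PowerSeries.C (p : ℤ_[p]) : IwasawaAlgebra p) ∣ f}.Finite := by
  set S : Set ℕ := {m : ℕ | 1 ≤ m ∧
      (PowerSeries.X ^ m + PowerSeries.C (p : ℤ_[p]) : IwasawaAlgebra p) ∣ f} with hS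
  have key : ∀ m ∈ S, ∃ q ∈ UniqueFactorizationMonoid.factors f,
      Associated (PowerSeries.X ^ m + PowerSeries.C (p : ℤ_[p]) : IwasawaAlgebra p) q :=
    fun m hm => UniqueFactorizationMonoid.exists_mem_factors_of_dvd hf
      (prime_X_pow_add_C p hm.1).irreducible hm.2
  choose q hqmem hq using key
  let F : Finset (IwasawaAlgebra p) := (UniqueFactorizationMonoid.factors f).toFinset
  let φ : S → F := fun m => ⟨q m.1 m.2, Multiset.mem_toFinset.mpr (hqmem m.1 m.2)⟩
  have hφ : Function.Injective φ := by
    rintro ⟨m, hm⟩ ⟨m', hm'⟩ h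
    have hqq : q m hm = q m' hm' := congrArg Subtype.val h
    have h' : Associated (PowerSeries.X ^ m' + PowerSeries.C (p : ℤ_[p]) : IwasawaAlgebra p) (q m hm) := by
      rw [hqq]; exact hq m' hm'
    exact Subtype.ext (eq_of_associated_X_pow_add_C p hm.1 hm'.1 ((hq m hm).trans h'.symm))
  haveI : Finite S := Finite.of_injective φ hφ
  exact Set.toFinite S

/-! ## §3 `Λ/(f, q_m)` is finite when `q_m ∤ f` -/

/-- **`Λ/(f, q_m)` is finite if `q_m ∤ f`** (`m ≥ 1`): the ideal `(f, q_m)` is non-zero and lies in no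
proper principal ideal (a non-unit dividing the prime `q_m` is associated to it, and then `q_m ∣ f`), so
the quotient is pseudo-null, i.e. finite (`finite_quotient_of_forall_not_le_span`).
[cite: NeukirchSchmidtWingberg2008, Ch. V §1 (5.1.4) Remark 4] [cite: Washington1997, §13.2] -/
theorem finite_quotient_span_pair_X_pow_add_C {f : IwasawaAlgebra p} {m : ℕ} (hm : 1 ≤ m)
    (h : ¬ (PowerSeries.X ^ m + PowerSeries.C (p : ℤ_[p]) : IwasawaAlgebra p) ∣ f) :
    Finite (IwasawaAlgebra p ⧸
      Ideal.span ({f, (PowerSeries.X ^ m + PowerSeries.C (p : ℤ_[p]) : IwasawaAlgebra p)} :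
        Set (IwasawaAlgebra p))) := by
  refine finite_quotient_of_forall_not_le_span _ ?_ ?_
  · intro hbot
    have hmem : (PowerSeries.X ^ m + PowerSeries.C (p : ℤ_[p]) : IwasawaAlgebra p) ∈
        Ideal.span ({f, (PowerSeries.X ^ m + PowerSeries.C (p : ℤ_[p]) : IwasawaAlgebra p)} :
          Set (IwasawaAlgebra p)) :=
      Ideal.subset_span (by simp)
    rw [hbot, Ideal.mem_bot] at hmem
    exact X_pow_add_C_ne_zero p m hmem
  · intro π hπ hle
    have hθ : (PowerSeries.X ^ m + PowerSeries.C (p : ℤ_[p]) : IwasawaAlgebra p) ∈ Ideal.span {π} :=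
      hle (Ideal.subset_span (by simp))
    have hfπ : f ∈ Ideal.span {π} := hle (Ideal.subset_span (by simp))
    rw [Ideal.mem_span_singleton] at hθ hfπ
    obtain ⟨u, hu⟩ := hθ
    rcases (prime_X_pow_add_C p hm).irreducible.isUnit_or_isUnit hu with hπu | huu
    · exact hπ hπu
    · apply h
      obtain ⟨v, rfl⟩ := huu
      have hπeq : π = (PowerSeries.X ^ m + PowerSeries.C (p : ℤ_[p])) * (↑v⁻¹ : IwasawaAlgebra p) := by
        rw [hu, mul_assoc, Units.mul_inv, mul_one]
      rw [hπeq] at hfπ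
      exact (dvd_mul_right _ _).trans hfπ

section Module

variable {M : Type*} [AddCommGroup M] [Module (IwasawaAlgebra p) M]

/-- **A finitely generated `Λ`-module killed by `f` and by `q_m` with `q_m ∤ f` is finite** (it is a
module over the finite ring `Λ/(f, q_m)`). [cite: NeukirchSchmidtWingberg2008, Ch. V §1 (5.1.4) Remark 4] -/
theorem finite_of_smul_eq_zero_of_not_X_pow_add_C_dvd [Module.Finite (IwasawaAlgebra p) M]
    {f : IwasawaAlgebra p} {m : ℕ} (hm : 1 ≤ m)
    (h : ¬ (PowerSeries.X ^ m + PowerSeries.C (p : ℤ_[p]) : IwasawaAlgebra p) ∣ f)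
    (hf : ∀ x : M, f • x = 0)
    (hθ : ∀ x : M, (PowerSeries.X ^ m + PowerSeries.C (p : ℤ_[p]) : IwasawaAlgebra p) • x = 0) :
    Finite M := by
  haveI := finite_quotient_span_pair_X_pow_add_C p hm h
  refine finite_of_finite_quotient_of_le_annihilator p
    (Ideal.span ({f, (PowerSeries.X ^ m + PowerSeries.C (p : ℤ_[p]) : IwasawaAlgebra p)} :
      Set (IwasawaAlgebra p))) ?_
  rw [Ideal.span_le]
  intro a ha
  simp only [Set.mem_insert_iff, Set.mem_singleton_iff] at ha
  rcases ha with rfl | rfl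
  · exact Module.mem_annihilator.mpr hf
  · exact Module.mem_annihilator.mpr hθ

/-! ## §4 `M[q_m]` is finite for all but finitely many `m` (`M` finitely generated) -/

/-- **Generic finiteness of the `q_m`-torsion.** Let `M` be a finitely generated `Λ`-module. Then
`M[q_m] = ker(M →(q_m)· M)` is finite for all but finitely many `m`: the exceptional `m` are among
those `m ≥ 1` with `q_m ∣ f`, where `f ≠ 0` is an annihilator of the torsion submodule
`M_{Λ-tors} ⊇ M[q_m]` (for `m = 0`, `q_0 = 1 + p` is a unit and `M[q_0] = 0`). Greenberg's
generic-twist argument along the Eisenstein family. [cite: GreenbergLNM1716, §4 p. 117 (proof of Prop. 4.9)]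
[cite: Howard2004HeegnerKolyvagin, proof of Thm. 2.2.10] -/
theorem finite_setOf_not_finite_torsionBy_X_pow_add_C [Module.Finite (IwasawaAlgebra p) M] :
    {m : ℕ | ¬ Finite (Submodule.torsionBy (IwasawaAlgebra p) M
        (PowerSeries.X ^ m + PowerSeries.C (p : ℤ_[p]) : IwasawaAlgebra p))}.Finite := by
  haveI : IsNoetherian (IwasawaAlgebra p) M := inferInstance
  obtain ⟨f, hfann, hf0⟩ := Submodule.annihilator_top_inter_nonZeroDivisors
    (R := IwasawaAlgebra p) (M := Submodule.torsion (IwasawaAlgebra p) M)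
    (Submodule.torsion_isTorsion)
  have hf0' : f ≠ 0 := nonZeroDivisors.ne_zero hf0
  refine (finite_setOf_X_pow_add_C_dvd p hf0').subset ?_
  rintro m hnot
  change ¬ Finite _ at hnot
  -- `m = 0`: `q_0 = 1 + p` is a unit, so `M[q_0] = 0` is finite
  have hm : 1 ≤ m := by
    by_contra hm0
    have hm0' : m = 0 := by omega
    subst hm0'
    apply hnot
    have hu : IsUnit (PowerSeries.X ^ 0 + PowerSeries.C (p : ℤ_[p]) : IwasawaAlgebra p) := by
      rw [PowerSeries.isUnit_iff_constantCoeff, map_add, pow_zero, map_one, PowerSeries.constantCoeff_C]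
      have : (1 : ℤ_[p]) + p ∉ IsLocalRing.maximalIdeal ℤ_[p] := by
        intro hmem
        have hpmem : (p : ℤ_[p]) ∈ IsLocalRing.maximalIdeal ℤ_[p] := by
          rw [PadicInt.maximalIdeal_eq_span_p]; exact Ideal.mem_span_singleton_self _
        have h1 : (1 : ℤ_[p]) ∈ IsLocalRing.maximalIdeal ℤ_[p] := by
          simpa using Submodule.sub_mem _ hmem hpmem
        exact (IsLocalRing.maximalIdeal.isMaximal ℤ_[p]).ne_top
          ((Ideal.eq_top_iff_one _).mpr h1)
      exact (IsLocalRing.notMem_maximalIdeal).mp this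
    have hbot : Submodule.torsionBy (IwasawaAlgebra p) M
        (PowerSeries.X ^ 0 + PowerSeries.C (p : ℤ_[p]) : IwasawaAlgebra p) = ⊥ :=
      (isSMulRegular_iff_torsionBy_eq_bot M _).mp (hu.isSMulRegular M)
    rw [hbot]
    infer_instance
  refine ⟨hm, ?_⟩
  by_contra hndvd
  apply hnot
  refine finite_of_smul_eq_zero_of_not_X_pow_add_C_dvd p hm hndvd ?_ ?_
  · rintro ⟨x, hx⟩
    have hxt : x ∈ Submodule.torsion (IwasawaAlgebra p) M :=
      ⟨⟨PowerSeries.X ^ m + PowerSeries.C (p : ℤ_[p]),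
        mem_nonZeroDivisors_of_ne_zero (X_pow_add_C_ne_zero p m)⟩,
        (Submodule.mem_torsionBy_iff _ _).mp hx⟩
    have h1 := (Submodule.mem_annihilator.mp hfann) ⟨x, hxt⟩ Submodule.mem_top
    apply Subtype.ext
    have h2 := congrArg Subtype.val h1
    simpa using h2
  · rintro ⟨x, hx⟩
    exact Subtype.ext ((Submodule.mem_torsionBy_iff _ _).mp hx)

/-- Existential form of `finite_setOf_not_finite_torsionBy_X_pow_add_C`: beyond some `m₀` every
`M[q_m]` is finite. [cite: GreenbergLNM1716, §4 p. 117] -/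
theorem exists_forall_finite_torsionBy_X_pow_add_C [Module.Finite (IwasawaAlgebra p) M] :
    ∃ m₀ : ℕ, ∀ m, m₀ ≤ m → Finite (Submodule.torsionBy (IwasawaAlgebra p) M
        (PowerSeries.X ^ m + PowerSeries.C (p : ℤ_[p]) : IwasawaAlgebra p)) := by
  have hfin := finite_setOf_not_finite_torsionBy_X_pow_add_C p (M := M)
  obtain ⟨m₀, hm₀⟩ := hfin.bddAbove
  refine ⟨m₀ + 1, fun m hm => ?_⟩
  by_contra hnot
  have := hm₀ hnot
  omega

end Module

/-! ## §5 The largest finite submodule of a Noetherian module -/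

section MaxFinite

variable {R : Type*} [Ring R] {M : Type*} [AddCommGroup M] [Module R M]

/-- The sum of two finite submodules is finite (it is the image of `F × G` under addition).
[folklore] -/
private theorem finite_sup_of_finite (F G : Submodule R M) [Finite F] [Finite G] : Finite ↥(F ⊔ G) := by
  let φ : F × G → ↥(F ⊔ G) := fun x =>
    ⟨(x.1 : M) + x.2, Submodule.add_mem _ (Submodule.mem_sup_left x.1.2) (Submodule.mem_sup_right x.2.2)⟩
  refine Finite.of_surjective φ ?_
  rintro ⟨z, hz⟩
  obtain ⟨x, hx, y, hy, rfl⟩ := Submodule.mem_sup.mp hz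
  exact ⟨(⟨x, hx⟩, ⟨y, hy⟩), rfl⟩

/-- **The largest finite submodule.** A Noetherian module `M` has a finite submodule `M_fin`
containing every finite submodule (a maximal element of the non-empty family of finite submodules;
it absorbs any finite `G` since `M_fin + G` is again finite). For `Λ`-modules this is the maximal
finite (= maximal pseudo-null) submodule. [cite: NeukirchSchmidtWingberg2008, Ch. V §1 (5.1.4) Remark 4 and (5.3.1)]
[cite: Washington1997, §13.2] -/
theorem exists_finite_submodule_forall_finite_le [IsNoetherian R M] :
    ∃ F : Submodule R M, Finite F ∧ ∀ G : Submodule R M, Finite G → G ≤ F := by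
  have hne : ({F : Submodule R M | Finite F} : Set (Submodule R M)).Nonempty :=
    ⟨⊥, (inferInstance : Finite (⊥ : Submodule R M))⟩
  obtain ⟨F, hF, hmax⟩ := set_has_maximal_iff_noetherian.mpr (inferInstance : IsNoetherian R M) _ hne
  refine ⟨F, hF, fun G hG => ?_⟩
  haveI : Finite F := hF
  haveI : Finite G := hG
  have hsup : Finite ↥(F ⊔ G) := finite_sup_of_finite F G
  have hnot : ¬ F < F ⊔ G := hmax _ hsup
  have hEq : F = F ⊔ G := by
    rcases (le_sup_left : F ≤ F ⊔ G).lt_or_eq with h | h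
    · exact absurd h hnot
    · exact h
  rw [hEq]
  exact le_sup_right

/-- **`M / M_fin` has no non-zero finite submodule**: if `F` is a finite submodule containing every
finite submodule of `M`, then every finite submodule of `M ⧸ F` is zero (its preimage in `M` is
finite — covered by `N × F` through a set-theoretic section of `M → M/F` — hence inside `F`).
[cite: NeukirchSchmidtWingberg2008, Ch. V §1 (5.3.1)] [cite: GreenbergLNM1716, §4 p. 117] -/
theorem forall_finite_eq_bot_quotient_of_forall_finite_le (F : Submodule R M) [Finite F]
    (hF : ∀ G : Submodule R M, Finite G → G ≤ F) :
    ∀ N : Submodule R (M ⧸ F), Finite N → N = ⊥ := by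
  intro N hN
  haveI : Finite N := hN
  -- the preimage of `N` in `M`
  let G : Submodule R M := N.comap F.mkQ
  -- a set-theoretic section of the quotient map
  have hsec : ∀ n : M ⧸ F, ∃ x : M, F.mkQ x = n := fun n => Submodule.mkQ_surjective F n
  choose s hs using hsec
  have hGfin : Finite G := by
    let ψ : N × F → G := fun x =>
      ⟨s x.1 + (x.2 : M), by
        change F.mkQ (s x.1 + (x.2 : M)) ∈ N
        rw [map_add, hs, Submodule.mkQ_apply, (Submodule.Quotient.mk_eq_zero F).mpr x.2.2, add_zero]
        exact x.1.2⟩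
    refine Finite.of_surjective ψ ?_
    rintro ⟨x, hx⟩
    have hxN : F.mkQ x ∈ N := hx
    have hdiff : x - s (F.mkQ x) ∈ F := by
      rw [← Submodule.Quotient.mk_eq_zero F, ← Submodule.mkQ_apply, map_sub, hs, sub_self]
    refine ⟨(⟨F.mkQ x, hxN⟩, ⟨x - s (F.mkQ x), hdiff⟩), Subtype.ext ?_⟩
    change s (F.mkQ x) + (x - s (F.mkQ x)) = x
    abel
  have hGF : G ≤ F := hF G hGfin
  rw [eq_bot_iff]
  intro n hn
  obtain ⟨x, rfl⟩ := Submodule.mkQ_surjective F n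
  have hxG : x ∈ G := hn
  rw [Submodule.mem_bot, Submodule.mkQ_apply, Submodule.Quotient.mk_eq_zero]
  exact hGF hxG

end MaxFinite

/-! ## §6 MAIN: `M[q_m] ⊆ M_fin` for all but finitely many `m`; a uniform bound on `#M[q_m]` -/

section Main

variable {M : Type*} [AddCommGroup M] [Module (IwasawaAlgebra p) M]

/-- **The `q_m`-torsion lies in the largest finite submodule for all but finitely many `m`.** Let
`M` be a finitely generated `Λ`-module and `F` a finite submodule containing every finite submodule
of `M`. Then `M[q_m] ≤ F` for all but finitely many `m`: on `N = M/F`, which has no non-zero finite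
submodule, `N[q_m]` is finite for all but finitely many `m` (§4), hence zero (Greenberg's mechanism,
`torsionBy_eq_bot_of_forall_finite_eq_bot`), and `M[q_m]` maps into `N[q_m]`.
[cite: GreenbergLNM1716, §4 p. 117 and p. 124] [cite: Howard2004HeegnerKolyvagin, proof of Thm. 2.2.10 (𝔮 = T^m + p)] -/
theorem finite_setOf_not_torsionBy_X_pow_add_C_le [Module.Finite (IwasawaAlgebra p) M]
    (F : Submodule (IwasawaAlgebra p) M) [Finite F]
    (hF : ∀ G : Submodule (IwasawaAlgebra p) M, Finite G → G ≤ F) :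
    {m : ℕ | ¬ Submodule.torsionBy (IwasawaAlgebra p) M
        (PowerSeries.X ^ m + PowerSeries.C (p : ℤ_[p]) : IwasawaAlgebra p) ≤ F}.Finite := by
  have hquot := forall_finite_eq_bot_quotient_of_forall_finite_le F hF
  haveI : Module.Finite (IwasawaAlgebra p) (M ⧸ F) := inferInstance
  refine (finite_setOf_not_finite_torsionBy_X_pow_add_C p (M := M ⧸ F)).subset ?_
  intro m hm
  change ¬ _ ≤ F at hm
  change ¬ Finite _
  intro hfin
  apply hm
  have hbot := torsionBy_eq_bot_of_forall_finite_eq_bot p hquot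
    (PowerSeries.X ^ m + PowerSeries.C (p : ℤ_[p]) : IwasawaAlgebra p)
  intro x hx
  have hx' : F.mkQ x ∈ Submodule.torsionBy (IwasawaAlgebra p) (M ⧸ F)
      (PowerSeries.X ^ m + PowerSeries.C (p : ℤ_[p]) : IwasawaAlgebra p) := by
    rw [Submodule.mem_torsionBy_iff] at hx ⊢
    rw [← map_smul, hx, map_zero]
  rw [hbot, Submodule.mem_bot, Submodule.mkQ_apply, Submodule.Quotient.mk_eq_zero] at hx'
  exact hx'

/-- **Main theorem, submodule form.** A finitely generated `Λ`-module `M` has a FINITE submodule `F`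
(its largest finite submodule) with `M[q_m] ⊆ F` for all but finitely many `m`.
[cite: GreenbergLNM1716, §4 p. 117] [cite: Howard2004HeegnerKolyvagin, proof of Thm. 2.2.10 (𝔮 = T^m + p)] -/
theorem exists_finite_setOf_not_torsionBy_X_pow_add_C_le [Module.Finite (IwasawaAlgebra p) M] :
    ∃ F : Submodule (IwasawaAlgebra p) M, Finite F ∧
      {m : ℕ | ¬ Submodule.torsionBy (IwasawaAlgebra p) M
        (PowerSeries.X ^ m + PowerSeries.C (p : ℤ_[p]) : IwasawaAlgebra p) ≤ F}.Finite := by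
  haveI : IsNoetherian (IwasawaAlgebra p) M := inferInstance
  obtain ⟨F, hF, hmax⟩ := exists_finite_submodule_forall_finite_le (R := IwasawaAlgebra p) (M := M)
  haveI : Finite F := hF
  exact ⟨F, hF, finite_setOf_not_torsionBy_X_pow_add_C_le p F hmax⟩

/-- **Main theorem, threshold form.** For a finitely generated `Λ`-module `M` there are a finite
submodule `F` and an `m₀` with `M[q_m] ⊆ F` for every `m ≥ m₀`.
[cite: GreenbergLNM1716, §4 p. 117] [cite: Howard2004HeegnerKolyvagin, proof of Thm. 2.2.10 (𝔮 = T^m + p)] -/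
theorem exists_forall_torsionBy_X_pow_add_C_le [Module.Finite (IwasawaAlgebra p) M] :
    ∃ (F : Submodule (IwasawaAlgebra p) M) (m₀ : ℕ), Finite F ∧ ∀ m, m₀ ≤ m →
      Submodule.torsionBy (IwasawaAlgebra p) M
        (PowerSeries.X ^ m + PowerSeries.C (p : ℤ_[p]) : IwasawaAlgebra p) ≤ F := by
  obtain ⟨F, hF, hfin⟩ := exists_finite_setOf_not_torsionBy_X_pow_add_C_le p (M := M)
  obtain ⟨m₀, hm₀⟩ := hfin.bddAbove
  refine ⟨F, m₀ + 1, hF, fun m hm => ?_⟩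
  by_contra hnot
  have := hm₀ hnot
  omega

/-- **Main theorem, cardinality form (the `m`-uniform bound).** For a finitely generated `Λ`-module
`M` there are `B ≥ 1` and `m₀` such that `M[q_m]` is finite with `#M[q_m] ≤ B` for every `m ≥ m₀`
(`B = #M_fin`). This is the shape in which the `𝔮`-torsion error terms of the control theorem at
`𝔮 = q_m` enter a specialised Kolyvagin-system inequality with a constant independent of `m`.
[cite: Howard2004HeegnerKolyvagin, proof of Thm. 2.2.10 and Prop. 2.2.8] [cite: GreenbergLNM1716, §4 p. 117] -/
theorem exists_forall_nat_card_torsionBy_X_pow_add_C_le [Module.Finite (IwasawaAlgebra p) M] :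
    ∃ B m₀ : ℕ, 1 ≤ B ∧ ∀ m, m₀ ≤ m →
      Finite (Submodule.torsionBy (IwasawaAlgebra p) M
        (PowerSeries.X ^ m + PowerSeries.C (p : ℤ_[p]) : IwasawaAlgebra p)) ∧
      Nat.card (Submodule.torsionBy (IwasawaAlgebra p) M
        (PowerSeries.X ^ m + PowerSeries.C (p : ℤ_[p]) : IwasawaAlgebra p)) ≤ B := by
  obtain ⟨F, m₀, hF, hle⟩ := exists_forall_torsionBy_X_pow_add_C_le p (M := M)
  haveI : Finite F := hF
  refine ⟨Nat.card F, m₀, ?_, fun m hm => ?_⟩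
  · haveI : Nonempty F := ⟨0⟩
    exact Nat.one_le_iff_ne_zero.mpr Nat.card_pos.ne'
  · have hinj : Function.Injective (Submodule.inclusion (hle m hm)) := Submodule.inclusion_injective _
    haveI : Finite (Submodule.torsionBy (IwasawaAlgebra p) M
        (PowerSeries.X ^ m + PowerSeries.C (p : ℤ_[p]) : IwasawaAlgebra p)) :=
      Finite.of_injective _ hinj
    exact ⟨inferInstance, Nat.card_le_card_of_injective _ hinj⟩

/-- **No finite submodule ⟹ `M[q_m] = 0` for all but finitely many `m`.** In a finitely generated
`Λ`-module without non-zero finite submodules (e.g. a torsion-free one, or Greenberg's `X(E/K_∞)`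
in the cases of LNM 1716 Prop. 4.14/4.15) the `q_m`-torsion VANISHES for all but finitely many `m`,
i.e. `q_m` is `M`-regular. [cite: GreenbergLNM1716, §4 p. 117 and p. 124]
[cite: Howard2004HeegnerKolyvagin, proof of Thm. 2.2.10 (𝔮 = T^m + p)] -/
theorem finite_setOf_torsionBy_X_pow_add_C_ne_bot [Module.Finite (IwasawaAlgebra p) M]
    (h : ∀ N : Submodule (IwasawaAlgebra p) M, Finite N → N = ⊥) :
    {m : ℕ | Submodule.torsionBy (IwasawaAlgebra p) M
        (PowerSeries.X ^ m + PowerSeries.C (p : ℤ_[p]) : IwasawaAlgebra p) ≠ ⊥}.Finite := by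
  refine (finite_setOf_not_finite_torsionBy_X_pow_add_C p (M := M)).subset ?_
  intro m hm
  change _ ≠ ⊥ at hm
  change ¬ Finite _
  intro hfin
  exact hm (torsionBy_eq_bot_of_forall_finite_eq_bot p h _)

/-- Threshold form of `finite_setOf_torsionBy_X_pow_add_C_ne_bot`: beyond some `m₀`, `q_m` is
`M`-regular (`M[q_m] = 0`) on a finitely generated `Λ`-module without non-zero finite submodules.
[cite: GreenbergLNM1716, §4 p. 117 and p. 124] -/
theorem exists_forall_torsionBy_X_pow_add_C_eq_bot [Module.Finite (IwasawaAlgebra p) M]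
    (h : ∀ N : Submodule (IwasawaAlgebra p) M, Finite N → N = ⊥) :
    ∃ m₀ : ℕ, ∀ m, m₀ ≤ m → Submodule.torsionBy (IwasawaAlgebra p) M
        (PowerSeries.X ^ m + PowerSeries.C (p : ℤ_[p]) : IwasawaAlgebra p) = ⊥ := by
  obtain ⟨m₀, hm₀⟩ := (finite_setOf_torsionBy_X_pow_add_C_ne_bot p h).bddAbove
  refine ⟨m₀ + 1, fun m hm => ?_⟩
  by_contra hnot
  have := hm₀ hnot
  omega

/-- The torsion-free case: if `M` has no `Λ`-torsion then `M[q_m] = 0` for EVERY `m`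
(`q_m ≠ 0` in the domain `Λ`). [cite: Washington1997, §13.2] -/
theorem torsionBy_X_pow_add_C_eq_bot_of_noZeroSMulDivisors [NoZeroSMulDivisors (IwasawaAlgebra p) M]
    (m : ℕ) :
    Submodule.torsionBy (IwasawaAlgebra p) M
        (PowerSeries.X ^ m + PowerSeries.C (p : ℤ_[p]) : IwasawaAlgebra p) = ⊥ := by
  rw [eq_bot_iff]
  intro x hx
  rw [Submodule.mem_torsionBy_iff] at hx
  rw [Submodule.mem_bot]
  rcases smul_eq_zero.mp hx with h | h
  · exact absurd h (X_pow_add_C_ne_zero p m)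
  · exact h

end Main

end Literature.NumberTheory.EllipticCurves.IwasawaAlgebra

end
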